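/-
Origin: expansion seat `planner-pub-hodgecm-pv05-g7-0`, handover #6 2026-08-18T14:19:18Z (`HOME/pub-hodgecm-pv05-g7/lean/Pv05g7/FockCoreDynamics.lean`, md5 d2814d1b, 199 lines);
landed by the gen-8 packager in gate run 30 as `HodgeCM/PerL34/FockCoreDynamics.lean` (import ^import Pv05g7\.FockInfinitesimalLie[ \t]*$→import HodgeCM.PerL34.FockInfinitesimalLie ×1; import ^import Pv05g7\.FockAnalyticVectors[ \t]*$→import HodgeCM.PerL34.FockAnalyticVectors ×1).
-/
/-
Origin: expansion seat `planner-pub-hodgecm-pv05-g7-0` (unit pub-hodgecm-pv05-g7, DAG-NODE PROVER #05 gen 7), leaf #6.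
Handover imports: `Pv05g7.FockInfinitesimalLie` ↦ `HodgeCM.PerL34.FockInfinitesimalLie` (pv05-g7 #3) and
`Pv05g7.FockAnalyticVectors` ↦ `HodgeCM.PerL34.FockAnalyticVectors` (pv05-g7 #5); the two `Mathlib.Analysis.*` imports stay.

# The polynomial core DETERMINES the dynamics: uniqueness of `u′ = dΓ(X)u` and of `ν₀(e^{tX})`

KERNEL, additive leaf of the pv05 Fock lane (namespace `HodgeCM.PerL34.Fock.Hermite`).  Mathlib + lane only; no
citation is used as a hypothesis; every statement quantifies over `[Fintype σ] [DecidableEq σ]`, a matrix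
`X : Matrix σ σ ℂ` with the displayed `star X = -X`, and POLYNOMIAL vectors `fockToL2 F = F·e^{−(π/2)|z|²} ∈ 𝓕_σ`.

What the earlier leaves give: `dΓ(X)` is skew-symmetric on the core (`inner_fockToL2_dGamma_of_star_eq_neg`, #3), the
genuine one-parameter unitary group `t ↦ ν₀(e^{tX}) = fockRep (expUnitary X hX t)` preserves the core and solves
`u′ = dΓ(X)u` there (`hasDerivAt_fockRep_expUnitary'`, #4), with the norm-convergent exponential series
(`hasSum_fockRep_expUnitary`, #5), and the core is dense (`fockToL2_denseRange`, `FockBargmann`).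

What this file proves (the UNIQUENESS half — "the generator on the core determines the group"):

1. `denseRange_fockToL2`, `eq_of_inner_fockToL2_eq` (a vector is determined by its inner products with the core),
   `ext_on_fockToL2` (two continuous maps on `𝓕` agreeing on the core are equal).
2. **Conservation law** `inner_fockRep_expUnitary_eq_of_hasDerivAt`: if `P : ℝ → ℂ[z]` is ANY polynomial-valued path whose
   Fock vectors solve the Schrödinger equation `(P t·e^{−…})′ = (dΓ(X)(P t))·e^{−…}` in `𝓕`, then
   `⟪ν₀(e^{tX})(G·e^{−…}), P t·e^{−…}⟫ = ⟪G·e^{−…}, P 0·e^{−…}⟫` for every polynomial `G` and every `t` (energy method: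
   the derivative vanishes by skew-symmetry of `dΓ(X)` and core-invariance of `ν₀(e^{tX})`).
3. **Uniqueness of core-valued solutions** `fockToL2_eq_fockRep_expUnitary_of_hasDerivAt`: such a path is FORCED to be
   `P t·e^{−…} = ν₀(e^{tX})(P 0·e^{−…})`; with the existence statement `hasDerivAt_fockToL2_linSubst_expUnitary`
   (`P t := P 0 ∘ e^{−tX}` is a solution) this is existence-and-uniqueness of the dynamics `u′ = dΓ(X)u` on the core.
4. **The group is determined by its generator on the core** `eq_fockRep_expUnitary_of_core`: a continuous map
   `T : 𝓕 → 𝓕` that transports the core along ANY solution family of `u′ = dΓ(X)u` up to time `t` IS `ν₀(e^{tX})`; and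
   `eq_fockRep_expUnitary_of_hasSum`: a continuous `T` given on the core by the exponential series `Σ tⁿ/n!·dΓ(X)ⁿ` IS `ν₀(e^{tX})`.

HONEST LABEL.  Polynomial core only: uniqueness is proved for CORE-VALUED solutions (`u t = P t·e^{−…}` with `P t` a
polynomial); nothing is claimed about solutions leaving the core, about Stone's theorem / essential skew-adjointness of
`dΓ(X)` on all of `𝓕`, or about the non-compact (metaplectic) directions.

ELABORATION NOTE (no axiom, file-local): `attribute [local instance 10000] InnerProductSpace.toInner`, as in #2/#3.
-/
import Mathlib.Analysis.InnerProductSpace.Calculus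
import Mathlib.Analysis.Calculus.MeanValue
import Summits.HodgeConjecture.HodgeCM.PerL34.FockInfinitesimalLie
import Summits.HodgeConjecture.HodgeCM.PerL34.FockAnalyticVectors

noncomputable section

namespace HodgeCM.PerL34.Fock.Hermite

open Complex MvPolynomial Matrix
open scoped Real InnerProductSpace Nat

variable {σ : Type*} [Fintype σ] [DecidableEq σ]

attribute [local instance 10000] InnerProductSpace.toInner

/-! ## §1  Density tools: the polynomial core determines vectors and continuous maps -/

omit [DecidableEq σ] in
/-- The polynomial vectors `F·e^{−(π/2)|z|²}` have dense range in `𝓕_σ`. -/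
theorem denseRange_fockToL2 : DenseRange (fockToL2 (σ := σ)) := by
  have h := Submodule.dense_iff_topologicalClosure_eq_top.mpr (fockToL2_denseRange (σ := σ))
  rwa [LinearMap.coe_range] at h

omit [DecidableEq σ] in
/-- A vector of `𝓕_σ` is determined by its inner products with the polynomial vectors. -/
theorem eq_of_inner_fockToL2_eq {x y : FockL2 σ}
    (h : ∀ G : MvPolynomial σ ℂ, ⟪fockToL2 G, x⟫_ℂ = ⟪fockToL2 G, y⟫_ℂ) : x = y :=
  DenseRange.eq_of_inner_right (𝕜 := ℂ) denseRange_fockToL2 h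

omit [DecidableEq σ] in
/-- Two continuous maps out of `𝓕_σ` (into a Hausdorff space) that agree on the polynomial vectors are equal. -/
theorem ext_on_fockToL2 {Y : Type*} [TopologicalSpace Y] [T2Space Y] {f g : FockL2 σ → Y}
    (hf : Continuous f) (hg : Continuous g) (h : ∀ F : MvPolynomial σ ℂ, f (fockToL2 F) = g (fockToL2 F)) :
    f = g :=
  Continuous.ext_on denseRange_fockToL2 hf hg (by rintro _ ⟨F, rfl⟩; exact h F)

/-! ## §2  Existence: `t ↦ (F ∘ e^{−tX})·e^{−…}` solves `u′ = dΓ(X)u` (repackaged from #4) -/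

/-- **Existence.**  For `Xᴴ = −X` the core-valued path `P t := F ∘ (e^{tX})ᴴ = F ∘ e^{−tX}` solves the Schrödinger
equation `(P t·e^{−…})′ = (dΓ(X)(P t))·e^{−…}` in `𝓕_σ` at every time. -/
theorem hasDerivAt_fockToL2_linSubst_expUnitary {X : Matrix σ σ ℂ} (hX : star X = -X)
    (F : MvPolynomial σ ℂ) (t : ℝ) :
    HasDerivAt (fun s : ℝ => fockToL2 (linSubst (star (expUnitary X hX s : Matrix σ σ ℂ)) F))
      (fockToL2 (dGamma X (linSubst (star (expUnitary X hX t : Matrix σ σ ℂ)) F))) t := by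
  simpa only [fockRep_expUnitary_fockToL2 hX] using hasDerivAt_fockRep_expUnitary' hX t F

/-- The existence path starts at `F`. -/
theorem linSubst_star_expUnitary_zero {X : Matrix σ σ ℂ} (hX : star X = -X) (F : MvPolynomial σ ℂ) :
    linSubst (star (expUnitary X hX 0 : Matrix σ σ ℂ)) F = F := by
  rw [expUnitary_zero, OneMemClass.coe_one, star_one, linSubst_one_apply]

/-! ## §3  The conservation law and uniqueness of core-valued solutions -/

/-- **Conservation law (energy method).**  If a polynomial-valued path `P` has Fock vectors solving
`(P t·e^{−…})′ = (dΓ(X)(P t))·e^{−…}`, then `s ↦ ⟪ν₀(e^{sX})(G·e^{−…}), P s·e^{−…}⟫` has derivative `0`: the two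
terms of the product rule cancel by the skew-symmetry of `dΓ(X)` on the core (#3) and `ν₀(e^{sX})(G·e^{−…}) =
(G∘e^{−sX})·e^{−…}` (#4). -/
theorem hasDerivAt_inner_fockRep_expUnitary {X : Matrix σ σ ℂ} (hX : star X = -X)
    {P : ℝ → MvPolynomial σ ℂ}
    (hP : ∀ t, HasDerivAt (fun s : ℝ => fockToL2 (P s)) (fockToL2 (dGamma X (P t))) t)
    (G : MvPolynomial σ ℂ) (s : ℝ) :
    HasDerivAt (fun r : ℝ => ⟪fockRep (expUnitary X hX r) (fockToL2 G), fockToL2 (P r)⟫_ℂ) 0 s := by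
  -- the value of the product rule, written with this file's `⟪·,·⟫_ℂ` elaboration, vanishes:
  have e : ⟪fockRep (expUnitary X hX s) (fockToL2 G), fockToL2 (dGamma X (P s))⟫_ℂ
      + ⟪fockToL2 (dGamma X (linSubst (star (expUnitary X hX s : Matrix σ σ ℂ)) G)), fockToL2 (P s)⟫_ℂ = 0 := by
    rw [fockRep_expUnitary_fockToL2 hX, inner_fockToL2_dGamma_of_star_eq_neg hX, add_neg_cancel]
  exact ((hasDerivAt_fockRep_expUnitary' hX s G).inner ℂ (hP s)).congr_deriv e

/-- **Conservation law, integrated form**: `⟪ν₀(e^{tX})(G·e^{−…}), P t·e^{−…}⟫ = ⟪G·e^{−…}, P 0·e^{−…}⟫`. -/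
theorem inner_fockRep_expUnitary_eq_of_hasDerivAt {X : Matrix σ σ ℂ} (hX : star X = -X)
    {P : ℝ → MvPolynomial σ ℂ}
    (hP : ∀ t, HasDerivAt (fun s : ℝ => fockToL2 (P s)) (fockToL2 (dGamma X (P t))) t)
    (G : MvPolynomial σ ℂ) (t : ℝ) :
    ⟪fockRep (expUnitary X hX t) (fockToL2 G), fockToL2 (P t)⟫_ℂ = ⟪fockToL2 G, fockToL2 (P 0)⟫_ℂ := by
  have hd := hasDerivAt_inner_fockRep_expUnitary hX hP G
  have e := is_const_of_deriv_eq_zero (fun r => (hd r).differentiableAt) (fun r => (hd r).deriv) t 0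
  rw [e, expUnitary_zero, map_one, LinearIsometryEquiv.coe_one, id_eq]

/-- `G·e^{−…} = ν₀(e^{tX}) ν₀(e^{−tX}) (G·e^{−…})`. -/
theorem fockRep_expUnitary_fockRep_expUnitary_neg {X : Matrix σ σ ℂ} (hX : star X = -X) (t : ℝ) (v : FockL2 σ) :
    fockRep (expUnitary X hX t) (fockRep (expUnitary X hX (-t)) v) = v := by
  rw [expUnitary_neg, map_inv, LinearIsometryEquiv.coe_inv, LinearIsometryEquiv.apply_symm_apply]

/-- **Uniqueness of core-valued solutions of `u′ = dΓ(X)u`.**  For `Xᴴ = −X`: if `P : ℝ → ℂ[z_σ]` is ANY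
polynomial-valued path whose Fock vectors `u t = P t·e^{−(π/2)|z|²}` satisfy `u′(t) = (dΓ(X)(P t))·e^{−…}` in `𝓕_σ`
for every `t`, then `u t = ν₀(e^{tX}) u 0` for every `t`.  (With `hasDerivAt_fockToL2_linSubst_expUnitary`: the
dynamics `u′ = dΓ(X)u` on the polynomial core exists and is unique, and it is Folland's `ν₀(e^{tX})`.) -/
theorem fockToL2_eq_fockRep_expUnitary_of_hasDerivAt {X : Matrix σ σ ℂ} (hX : star X = -X)
    {P : ℝ → MvPolynomial σ ℂ}
    (hP : ∀ t, HasDerivAt (fun s : ℝ => fockToL2 (P s)) (fockToL2 (dGamma X (P t))) t) (t : ℝ) :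
    fockToL2 (P t) = fockRep (expUnitary X hX t) (fockToL2 (P 0)) := by
  refine eq_of_inner_fockToL2_eq fun G => ?_
  have e1 := fockRep_expUnitary_fockRep_expUnitary_neg hX t (fockToL2 G)
  calc ⟪fockToL2 G, fockToL2 (P t)⟫_ℂ
      = ⟪fockRep (expUnitary X hX t)
          (fockToL2 (linSubst (star (expUnitary X hX (-t) : Matrix σ σ ℂ)) G)), fockToL2 (P t)⟫_ℂ := by
        rw [← fockRep_expUnitary_fockToL2 hX (-t), e1]
    _ = ⟪fockToL2 (linSubst (star (expUnitary X hX (-t) : Matrix σ σ ℂ)) G), fockToL2 (P 0)⟫_ℂ :=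
        inner_fockRep_expUnitary_eq_of_hasDerivAt hX hP _ t
    _ = ⟪fockRep (expUnitary X hX t) (fockRep (expUnitary X hX (-t)) (fockToL2 G)),
          fockRep (expUnitary X hX t) (fockToL2 (P 0))⟫_ℂ := by
        rw [← fockRep_expUnitary_fockToL2 hX (-t), LinearIsometryEquiv.inner_map_map]
    _ = ⟪fockToL2 G, fockRep (expUnitary X hX t) (fockToL2 (P 0))⟫_ℂ := by rw [e1]

/-- Uniqueness with a prescribed initial polynomial `F₀`. -/
theorem fockToL2_eq_fockRep_expUnitary_of_hasDerivAt' {X : Matrix σ σ ℂ} (hX : star X = -X)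
    {P : ℝ → MvPolynomial σ ℂ} {F₀ : MvPolynomial σ ℂ} (h0 : P 0 = F₀)
    (hP : ∀ t, HasDerivAt (fun s : ℝ => fockToL2 (P s)) (fockToL2 (dGamma X (P t))) t) (t : ℝ) :
    fockToL2 (P t) = fockRep (expUnitary X hX t) (fockToL2 F₀) := by
  rw [← h0]; exact fockToL2_eq_fockRep_expUnitary_of_hasDerivAt hX hP t

/-- Two core-valued solutions with the same initial polynomial coincide (as polynomials). -/
theorem eq_of_hasDerivAt_dGamma {X : Matrix σ σ ℂ} (hX : star X = -X) {P Q : ℝ → MvPolynomial σ ℂ}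
    (hP : ∀ t, HasDerivAt (fun s : ℝ => fockToL2 (P s)) (fockToL2 (dGamma X (P t))) t)
    (hQ : ∀ t, HasDerivAt (fun s : ℝ => fockToL2 (Q s)) (fockToL2 (dGamma X (Q t))) t)
    (h0 : P 0 = Q 0) (t : ℝ) : P t = Q t := by
  apply fockToL2_injective
  rw [fockToL2_eq_fockRep_expUnitary_of_hasDerivAt hX hP t,
    fockToL2_eq_fockRep_expUnitary_of_hasDerivAt hX hQ t, h0]

/-- The solution through `F₀` is the explicit path of §2: `P t = F₀ ∘ e^{−tX}`. -/
theorem eq_linSubst_expUnitary_of_hasDerivAt {X : Matrix σ σ ℂ} (hX : star X = -X)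
    {P : ℝ → MvPolynomial σ ℂ}
    (hP : ∀ t, HasDerivAt (fun s : ℝ => fockToL2 (P s)) (fockToL2 (dGamma X (P t))) t) (t : ℝ) :
    P t = linSubst (star (expUnitary X hX t : Matrix σ σ ℂ)) (P 0) :=
  eq_of_hasDerivAt_dGamma hX hP (hasDerivAt_fockToL2_linSubst_expUnitary hX (P 0))
    (linSubst_star_expUnitary_zero hX (P 0)).symm t

/-! ## §4  The generator on the core determines `ν₀(e^{tX})` on all of `𝓕_σ` -/

/-- **The group is determined by its generator on the core (ODE form).**  Let `T : 𝓕_σ → 𝓕_σ` be continuous and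
suppose that for every polynomial `F` there is a polynomial-valued solution `Φ F` of `u′ = dΓ(X)u` starting at `F`
with `T (F·e^{−…}) = (Φ F t)·e^{−…}`.  Then `T = ν₀(e^{tX})`. -/
theorem eq_fockRep_expUnitary_of_core {X : Matrix σ σ ℂ} (hX : star X = -X) {T : FockL2 σ → FockL2 σ}
    (hT : Continuous T) (t : ℝ) (Φ : MvPolynomial σ ℂ → ℝ → MvPolynomial σ ℂ) (h0 : ∀ F, Φ F 0 = F)
    (hΦ : ∀ F s, HasDerivAt (fun r : ℝ => fockToL2 (Φ F r)) (fockToL2 (dGamma X (Φ F s))) s)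
    (hTΦ : ∀ F, T (fockToL2 F) = fockToL2 (Φ F t)) :
    T = fockRep (expUnitary X hX t) :=
  ext_on_fockToL2 hT (fockRep (expUnitary X hX t)).continuous fun F => by
    rw [hTΦ, fockToL2_eq_fockRep_expUnitary_of_hasDerivAt' hX (h0 F) (hΦ F) t]

/-- **The group is determined by its generator on the core (series form).**  A continuous `T : 𝓕_σ → 𝓕_σ` given on
every polynomial vector by the exponential series `T(F·e^{−…}) = Σₙ tⁿ/n!·(dΓ(X)ⁿF)·e^{−…}` IS `ν₀(e^{tX})`. -/
theorem eq_fockRep_expUnitary_of_hasSum {X : Matrix σ σ ℂ} (hX : star X = -X) {T : FockL2 σ → FockL2 σ}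
    (hT : Continuous T) (t : ℝ)
    (h : ∀ F : MvPolynomial σ ℂ,
      HasSum (fun n : ℕ => ((n ! : ℂ)⁻¹ * (t : ℂ) ^ n) • fockToL2 ((dGamma X ^ n) F)) (T (fockToL2 F))) :
    T = fockRep (expUnitary X hX t) :=
  ext_on_fockToL2 hT (fockRep (expUnitary X hX t)).continuous fun F =>
    (h F).unique (hasSum_fockRep_expUnitary hX F t)

/-- In particular two members `ν₀(e^{sX})`, `ν₀(e^{tX})` of the group agree iff they agree on the core; and a unitary
`U ∈ U(σ)` whose `ν₀(U)` transports the core along solutions of `u′ = dΓ(X)u` up to time `t` acts as `ν₀(e^{tX})`. -/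
theorem fockRep_eq_fockRep_expUnitary_of_core {X : Matrix σ σ ℂ} (hX : star X = -X) (U : Matrix.unitaryGroup σ ℂ)
    (t : ℝ) (Φ : MvPolynomial σ ℂ → ℝ → MvPolynomial σ ℂ) (h0 : ∀ F, Φ F 0 = F)
    (hΦ : ∀ F s, HasDerivAt (fun r : ℝ => fockToL2 (Φ F r)) (fockToL2 (dGamma X (Φ F s))) s)
    (hU : ∀ F, fockRep U (fockToL2 F) = fockToL2 (Φ F t)) :
    (fockRep U : FockL2 σ → FockL2 σ) = fockRep (expUnitary X hX t) :=
  eq_fockRep_expUnitary_of_core hX (fockRep U).continuous t Φ h0 hΦ hU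

end HodgeCM.PerL34.Fock.Hermite
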